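import Summits.CriticalPhenomena.CardyFormulaZ2.Theorems.CardyMagicRigidityNestingRigidityNeckFourArmInputsT
import Literature.Probability.Percolation.TriCorrLengthExponentDecomposition
import Literature.Probability.Percolation.ArmEventsProofs
import HarnessLib

/-!
# The two-radius four-arm bound with exponent `> 1` on site `𝕋` from Smirnov–Werner's scaling limit (stub S11, input I4T)

Crux `Summit.CriticalPhenomena.CardyFormulaZ2.Theses.CardyMagicRigidity.NestingRigidity` (stmt-CriticalPhenomena-4835),
line `pinch-resampling` v4, stub S11 `stub_neckHookupCoarseT`.  The summation behind `NeckHookupCoarseT` consumes the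
UNIFORM two-radius bound `π₄(r, R) ≤ C (r/R)^{1+ε}` (`1 ≤ r ≤ R`, some `ε > 0`) for the critical four-arm probability
of site percolation on `𝕋` (input (I4T), cluster form `FourArmTwoClustersBoundT` of `…NeckFourArmInputsT`, reduced there to
the tree's `critFourArmProb`).  No RSW-only proof of `α₄ > 1` is in the tree for site `𝕋` (Garban's multi-scale lemma is
proved for bond `ℤ²` only, `Garban2011_fourArm_multiscale_holds`); the tree's NAMED source for the four-arm decay on `𝕋` is
`Literature.Probability.Percolation.SmirnovWerner2001_fourArm_scalingLimit` (Smirnov–Werner 2001, (16)₄ + (9)₄: the ratio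
limit `b'(R/r) = lim_ρ π₄(ρr, ρR)` exists and `log b'(λ)/log λ → -5/4`).  This file proves the elementary bootstrap

  `critFourArmProb_twoRadius_of_scalingLimit : SmirnovWerner2001_fourArm_scalingLimit →
      ∃ ε C, 0 < ε ∧ ∀ 1 ≤ r ≤ R, critFourArmProb r R ≤ C (r/R)^{1+ε}`     (with `ε = 1/16`):

pick a ratio `M ≥ 2³³` with `b'(M) ≤ M^{-9/8}`, a scale `ρ₀` beyond which `π₄(ρ, Mρ) ≤ 2M^{-9/8} =: q`; chain the annuli
`Λ_{(M+1)^{i+1}ρ - 1} ∖ Λ_{(M+1)^i ρ}` by sub-multiplicativity (`polyArmProb_submult`) and monotonicity in both radii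
(`polyArmProb_anti_holds`, `armEvent_mono_left`): `π₄(ρ, (M+1)^j ρ) ≤ q^j ≤ (M+1)^{-17j/16}`; sandwich `R` between
consecutive powers of `M + 1` times `max r ρ₀`.  A fixed-inner-radius exponent statement such as `fourArm_exponent` would
NOT suffice for the two-radius form; the ratio limit does, without quasi-multiplicativity.  Corollary (anchor):
`fourArmTwoClustersBoundT_of_scalingLimit : SmirnovWerner2001_fourArm_scalingLimit → FourArmTwoClustersBoundT` — input (I4T)
of stub S11 is CONDITIONAL on exactly this one named fact of the tree (not proved there: Smirnov's theorem for the
four-arm ratio limit and the `SLE₆` annulus exponent).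
-/

noncomputable section

namespace Summit.CriticalPhenomena.CardyFormulaZ2.Cruxes.NestingRigidity.PinchResampling

open Filter Topology MeasureTheory Set Literature.Probability.Percolation Literature.Probability.LatticeModels

namespace NeckCoarse

/-- **Chaining blocks of ratio `M`.**  If `π₄(ρ, Mρ) ≤ q` for all `ρ ≥ ρ₀` (`1 ≤ M`, `1 ≤ ρ₀`, `0 ≤ q`), then
`π₄(ρ, (M+1)^j ρ) ≤ q^j` for all `ρ ≥ ρ₀` (sub-multiplicativity across `Λ_{(M+1)ρ-1}` and monotonicity in the outer radius). -/
theorem critFourArmProb_pow_le {M ρ₀ : ℕ} {q : ℝ} (hM : 1 ≤ M) (hρ₀ : 1 ≤ ρ₀) (hq : 0 ≤ q)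
    (h : ∀ ρ, ρ₀ ≤ ρ → critFourArmProb ρ (M * ρ) ≤ q) :
    ∀ j ρ, ρ₀ ≤ ρ → critFourArmProb ρ ((M + 1) ^ j * ρ) ≤ q ^ j := by
  intro j
  induction j with
  | zero =>
    intro ρ _
    rw [pow_zero, pow_zero, one_mul]
    exact polyArmProb_le_one _ _ _
  | succ j ih =>
    intro ρ hρ
    have hρ1 : 1 ≤ ρ := hρ₀.trans hρ
    have hK : 1 ≤ (M + 1) ^ j := Nat.one_le_pow _ _ (by omega)
    have h1 : ρ ≤ (M + 1) * ρ - 1 := by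
      have : 2 * ρ ≤ (M + 1) * ρ := Nat.mul_le_mul_right ρ (by omega)
      omega
    have h2 : (M + 1) * ρ - 1 < (M + 1) ^ (j + 1) * ρ := by
      have : (M + 1) * ρ ≤ (M + 1) ^ (j + 1) * ρ := by
        rw [pow_succ]
        exact Nat.mul_le_mul_right ρ (le_mul_of_one_le_left (Nat.zero_le _) hK)
      omega
    have hsub := polyArmProb_submult ![true, false, true, false] h1 h2
    have h3 : (M + 1) * ρ - 1 + 1 = (M + 1) * ρ := by
      have : 1 ≤ (M + 1) * ρ := Nat.one_le_iff_ne_zero.2 (by positivity)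
      omega
    rw [h3] at hsub
    -- first block: `π₄(ρ, (M+1)ρ - 1) ≤ π₄(ρ, Mρ) ≤ q`
    have hA : critFourArmProb ρ ((M + 1) * ρ - 1) ≤ q := by
      refine le_trans ?_ (h ρ hρ)
      refine polyArmProb_anti_holds _ (Nat.le_mul_of_pos_left ρ (by omega)) ?_
      have : (M + 1) * ρ = M * ρ + ρ := by ring
      omega
    -- remaining blocks by induction at the scale `(M+1)ρ`
    have hB : critFourArmProb ((M + 1) * ρ) ((M + 1) ^ (j + 1) * ρ) ≤ q ^ j := by
      have e : (M + 1) ^ (j + 1) * ρ = (M + 1) ^ j * ((M + 1) * ρ) := by ring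
      rw [e]
      exact ih _ (hρ.trans (Nat.le_mul_of_pos_left ρ (by omega)))
    calc critFourArmProb ρ ((M + 1) ^ (j + 1) * ρ)
        ≤ critFourArmProb ρ ((M + 1) * ρ - 1) * critFourArmProb ((M + 1) * ρ) ((M + 1) ^ (j + 1) * ρ) := hsub
      _ ≤ q * q ^ j := mul_le_mul hA hB (polyArmProb_nonneg _ _ _) hq
      _ = q ^ (j + 1) := by ring

/-- **A ratio with small limit value.**  From `log b'(λ)/log λ → -5/4`: some integer `M ≥ M₀` (any prescribed `M₀`) has
`b'(M) ≤ M^{-9/8}`. -/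
theorem exists_ratio_of_logLimit {b' : ℝ → ℝ}
    (hlog : Tendsto (fun l : ℝ ↦ Real.log (b' l) / Real.log l) atTop (𝓝 (-(5 / 4)))) (M₀ : ℕ) :
    ∃ M : ℕ, M₀ ≤ M ∧ 2 ≤ M ∧ b' M ≤ (M : ℝ) ^ (-(9 / 8) : ℝ) := by
  have hev : ∀ᶠ l : ℝ in atTop, Real.log (b' l) / Real.log l < -(9 / 8) :=
    hlog.eventually (gt_mem_nhds (by norm_num))
  obtain ⟨l₀, hl₀⟩ := Filter.eventually_atTop.1 hev
  refine ⟨max (max ⌈l₀⌉₊ 2) M₀, le_max_right _ _, (le_max_right _ _).trans (le_max_left _ _), ?_⟩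
  set M : ℕ := max (max ⌈l₀⌉₊ 2) M₀ with hM
  have hM2 : 2 ≤ M := (le_max_right _ _).trans (le_max_left _ _)
  have hMl₀ : l₀ ≤ M := (Nat.le_ceil l₀).trans (by exact_mod_cast (le_max_left _ _).trans (le_max_left _ _))
  have hM0 : (0 : ℝ) < M := by exact_mod_cast (by omega : 0 < M)
  have hlogM : 0 < Real.log M := Real.log_pos (by exact_mod_cast (by omega : 1 < M))
  have h1 := hl₀ M hMl₀
  rw [div_lt_iff₀ hlogM] at h1
  by_cases hb : 0 < b' M
  · have : Real.log (b' M) < Real.log ((M : ℝ) ^ (-(9 / 8) : ℝ)) := by rwa [Real.log_rpow hM0]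
    exact ((Real.log_lt_log_iff hb (Real.rpow_pos_of_pos hM0 _)).1 this).le
  · exact (not_lt.1 hb).trans (Real.rpow_pos_of_pos hM0 _).le

/-- **The numerical heart**: for `M ≥ 2³³`, `2 M^{-9/8} (M+1)^{17/16} ≤ 1`. -/
theorem two_mul_rpow_mul_rpow_le_one {M : ℕ} (hM : 2 ^ 33 ≤ M) :
    2 * (M : ℝ) ^ (-(9 / 8) : ℝ) * ((M : ℝ) + 1) ^ ((17 : ℝ) / 16) ≤ 1 := by
  have hM1 : (1 : ℝ) ≤ M := by exact_mod_cast le_trans (Nat.one_le_two_pow) hM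
  have hM0 : (0 : ℝ) < M := by linarith
  have hK0 : (0 : ℝ) < (M : ℝ) + 1 := by linarith
  have hq0 : 0 < 2 * (M : ℝ) ^ (-(9 / 8) : ℝ) := by positivity
  have hlogK : Real.log ((M : ℝ) + 1) ≤ Real.log 2 + Real.log M := by
    rw [← Real.log_mul two_ne_zero hM0.ne']
    exact Real.log_le_log hK0 (by linarith)
  have hlogM : 33 * Real.log 2 ≤ Real.log M := by
    have e33 : Real.log ((2 : ℝ) ^ 33) = 33 * Real.log 2 := by rw [Real.log_pow]; norm_num
    rw [← e33]
    exact Real.log_le_log (by positivity) (by exact_mod_cast hM)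
  have hlog2 : 0 < Real.log 2 := Real.log_pos one_lt_two
  have hle : Real.log (2 * (M : ℝ) ^ (-(9 / 8) : ℝ) * ((M : ℝ) + 1) ^ ((17 : ℝ) / 16)) ≤ 0 := by
    rw [Real.log_mul hq0.ne' (Real.rpow_pos_of_pos hK0 _).ne', Real.log_mul two_ne_zero (Real.rpow_pos_of_pos hM0 _).ne',
      Real.log_rpow hM0, Real.log_rpow hK0]
    nlinarith [hlogK, hlogM, hlog2]
  have hpos : 0 < 2 * (M : ℝ) ^ (-(9 / 8) : ℝ) * ((M : ℝ) + 1) ^ ((17 : ℝ) / 16) := by positivity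
  rwa [Real.log_nonpos_iff hpos.le] at hle

end NeckCoarse

/-- **The two-radius critical four-arm bound with exponent `> 1` on `𝕋` from Smirnov–Werner's scaling limit.**
For some `ε > 0` (here `1/16`) and `C`: `critFourArmProb r R ≤ C (r/R)^{1+ε}` for all `1 ≤ r ≤ R`. -/
theorem critFourArmProb_twoRadius_of_scalingLimit (hSW : SmirnovWerner2001_fourArm_scalingLimit) :
    ∃ ε C : ℝ, 0 < ε ∧ ∀ r R : ℕ, 1 ≤ r → r ≤ R → critFourArmProb r R ≤ C * ((r : ℝ) / R) ^ (1 + ε) := by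
  obtain ⟨b', hlim, hlog⟩ := hSW
  -- the ratio `M` and the block bound `q`
  obtain ⟨M, hM33, hM2, hbM⟩ := NeckCoarse.exists_ratio_of_logLimit hlog (2 ^ 33)
  have hM0 : (0 : ℝ) < M := by exact_mod_cast (by omega : 0 < M)
  set q : ℝ := 2 * (M : ℝ) ^ (-(9 / 8) : ℝ) with hq
  have hq0 : 0 < q := by positivity
  have hbq : b' ((M : ℝ) / ((1 : ℕ) : ℝ)) < q := by
    rw [Nat.cast_one, div_one, hq]
    have := Real.rpow_pos_of_pos hM0 (-(9 / 8) : ℝ)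
    linarith
  have hev : ∀ᶠ ρ : ℕ in atTop, critFourArmProb (ρ * 1) (ρ * M) < q :=
    (hlim 1 M le_rfl (by omega)).eventually_lt_const hbq
  obtain ⟨ρ₁, hρ₁⟩ := Filter.eventually_atTop.1 hev
  set ρ₀ : ℕ := max ρ₁ 1 with hρ₀
  have hρ₀1 : 1 ≤ ρ₀ := le_max_right _ _
  have hblock : ∀ ρ, ρ₀ ≤ ρ → critFourArmProb ρ (M * ρ) ≤ q := fun ρ hρ ↦ by
    have := hρ₁ ρ (le_of_max_le_left hρ)
    rw [mul_one, mul_comm] at this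
    exact this.le
  have hchain := NeckCoarse.critFourArmProb_pow_le (by omega : 1 ≤ M) hρ₀1 hq0.le hblock
  -- constants
  set e : ℝ := (17 : ℝ) / 16 with he
  have hK0 : (0 : ℝ) < (M : ℝ) + 1 := by linarith
  have hqK : q * ((M : ℝ) + 1) ^ e ≤ 1 := by
    rw [hq, he]; exact NeckCoarse.two_mul_rpow_mul_rpow_le_one hM33
  have hqle : q ≤ ((M : ℝ) + 1) ^ (-e) := by
    have hKe : 0 < ((M : ℝ) + 1) ^ e := Real.rpow_pos_of_pos hK0 _
    rw [Real.rpow_neg hK0.le]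
    calc q = q * ((M : ℝ) + 1) ^ e * (((M : ℝ) + 1) ^ e)⁻¹ := by field_simp
      _ ≤ 1 * (((M : ℝ) + 1) ^ e)⁻¹ := mul_le_mul_of_nonneg_right hqK (inv_nonneg.2 hKe.le)
      _ = (((M : ℝ) + 1) ^ e)⁻¹ := one_mul _
  refine ⟨1 / 16, (((M : ℝ) + 1) * ρ₀) ^ e, by norm_num, fun r R hr hrR ↦ ?_⟩
  have h1e : (1 : ℝ) + 1 / 16 = e := by rw [he]; norm_num
  rw [h1e]
  have hr0 : (0 : ℝ) < r := by exact_mod_cast hr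
  have hR0 : (0 : ℝ) < R := by exact_mod_cast hr.trans hrR
  have hρ₀0 : (0 : ℝ) < ρ₀ := by exact_mod_cast hρ₀1
  set r' : ℕ := max r ρ₀ with hr'
  have hr'ρ₀ : ρ₀ ≤ r' := le_max_right _ _
  have hr'le : (r' : ℝ) ≤ ρ₀ * r := by
    rcases le_total r ρ₀ with h | h
    · rw [hr', max_eq_right h]
      have : (1 : ℝ) ≤ r := by exact_mod_cast hr
      nlinarith
    · rw [hr', max_eq_left h]
      have : (1 : ℝ) ≤ ρ₀ := by exact_mod_cast hρ₀1
      nlinarith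
  have hx0 : 0 < (r : ℝ) / R := div_pos hr0 hR0
  by_cases hcase : (M + 1) * r' ≤ R
  · -- `(M+1)^j r' ≤ R < (M+1)^{j+1} r'`
    have hr'0 : 0 < r' := by omega
    set n : ℕ := R / r' with hn
    have hn1 : M + 1 ≤ n := by rw [hn]; exact (Nat.le_div_iff_mul_le hr'0).2 hcase
    set j : ℕ := Nat.log (M + 1) n with hj
    have hpow_le : (M + 1) ^ j ≤ n := Nat.pow_log_le_self _ (by omega)
    have hlt_pow : n < (M + 1) ^ (j + 1) := Nat.lt_pow_succ_log_self (by omega) n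
    have hRge : (M + 1) ^ j * r' ≤ R := by
      calc (M + 1) ^ j * r' ≤ n * r' := Nat.mul_le_mul_right _ hpow_le
        _ ≤ R := by rw [hn]; exact Nat.div_mul_le_self R r'
    have hRlt : R < (M + 1) ^ (j + 1) * r' := by
      calc R < R / r' * r' + r' := Nat.lt_div_mul_add hr'0
        _ = (n + 1) * r' := by rw [hn]; ring
        _ ≤ (M + 1) ^ (j + 1) * r' := Nat.mul_le_mul_right _ hlt_pow
    -- the arm bound
    have harm : critFourArmProb r R ≤ q ^ j := by
      calc critFourArmProb r R ≤ critFourArmProb r' R :=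
            measureReal_mono (armEvent_mono_left _ (le_max_left _ _) ((Nat.le_mul_of_pos_left r' (by positivity)).trans hRge))
              (measure_ne_top _ _)
        _ ≤ critFourArmProb r' ((M + 1) ^ j * r') :=
            polyArmProb_anti_holds _ (Nat.le_mul_of_pos_left r' (by positivity)) hRge
        _ ≤ q ^ j := hchain j r' hr'ρ₀
    -- the exponent bookkeeping: `q^j ≤ A^{-e} ≤ C (r/R)^e`, `A = (M+1)^j`
    set A : ℝ := ((M : ℝ) + 1) ^ j with hA
    have hA0 : 0 < A := by positivity
    have hqj : q ^ j ≤ A ^ (-e) := by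
      calc q ^ j ≤ (((M : ℝ) + 1) ^ (-e)) ^ j := pow_le_pow_left₀ hq0.le hqle j
        _ = A ^ (-e) := by
            rw [hA, ← Real.rpow_mul_natCast hK0.le, mul_comm, Real.rpow_natCast_mul hK0.le]
    have he0 : 0 ≤ e := by rw [he]; norm_num
    have hB0 : 0 < ((M : ℝ) + 1) * ρ₀ := by positivity
    -- `R ≤ (M+1)^{j+1} ρ₀ r = A · ((M+1) ρ₀) · r`
    have hRle : (R : ℝ) ≤ A * (((M : ℝ) + 1) * ρ₀) * r := by
      have h1 : (R : ℝ) < ((M : ℝ) + 1) ^ (j + 1) * r' := by exact_mod_cast hRlt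
      have h2 : ((M : ℝ) + 1) ^ (j + 1) * r' ≤ ((M : ℝ) + 1) ^ (j + 1) * (ρ₀ * r) :=
        mul_le_mul_of_nonneg_left hr'le (by positivity)
      calc (R : ℝ) ≤ ((M : ℝ) + 1) ^ (j + 1) * (ρ₀ * r) := by linarith
        _ = A * (((M : ℝ) + 1) * ρ₀) * r := by rw [hA]; ring
    have hABx : 1 ≤ A * ((((M : ℝ) + 1) * ρ₀) * ((r : ℝ) / R)) := by
      rw [show A * ((((M : ℝ) + 1) * ρ₀) * ((r : ℝ) / R)) = A * (((M : ℝ) + 1) * ρ₀) * r / R by ring, one_le_div hR0]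
      exact hRle
    have hinv : A⁻¹ ≤ (((M : ℝ) + 1) * ρ₀) * ((r : ℝ) / R) := by
      calc A⁻¹ = A⁻¹ * 1 := (mul_one _).symm
        _ ≤ A⁻¹ * (A * ((((M : ℝ) + 1) * ρ₀) * ((r : ℝ) / R))) := mul_le_mul_of_nonneg_left hABx (inv_nonneg.2 hA0.le)
        _ = (((M : ℝ) + 1) * ρ₀) * ((r : ℝ) / R) := by field_simp
    calc critFourArmProb r R ≤ q ^ j := harm
      _ ≤ A ^ (-e) := hqj
      _ = A⁻¹ ^ e := by rw [Real.rpow_neg hA0.le, Real.inv_rpow hA0.le]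
      _ ≤ ((((M : ℝ) + 1) * ρ₀) * ((r : ℝ) / R)) ^ e := Real.rpow_le_rpow (inv_nonneg.2 hA0.le) hinv he0
      _ = (((M : ℝ) + 1) * ρ₀) ^ e * ((r : ℝ) / R) ^ e := Real.mul_rpow hB0.le hx0.le
  · -- `R < (M+1) r' ≤ (M+1) ρ₀ r`: the bound is at least `1`
    have he0 : 0 ≤ e := by rw [he]; norm_num
    have hB0 : 0 < ((M : ℝ) + 1) * ρ₀ := by positivity
    have hRlt : R < (M + 1) * r' := not_le.1 hcase
    have hRle : (R : ℝ) ≤ ((M : ℝ) + 1) * ρ₀ * r := by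
      have h1 : (R : ℝ) < ((M : ℝ) + 1) * r' := by exact_mod_cast hRlt
      have h2 : ((M : ℝ) + 1) * r' ≤ ((M : ℝ) + 1) * (ρ₀ * r) := mul_le_mul_of_nonneg_left hr'le hK0.le
      linarith
    have hBx : 1 ≤ ((M : ℝ) + 1) * ρ₀ * ((r : ℝ) / R) := by
      rw [show ((M : ℝ) + 1) * ρ₀ * ((r : ℝ) / R) = ((M : ℝ) + 1) * ρ₀ * r / R by ring, one_le_div hR0]
      exact hRle
    calc critFourArmProb r R ≤ 1 := polyArmProb_le_one _ _ _
      _ ≤ (((M : ℝ) + 1) * ρ₀ * ((r : ℝ) / R)) ^ e := Real.one_le_rpow hBx he0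
      _ = (((M : ℝ) + 1) * ρ₀) ^ e * ((r : ℝ) / R) ^ e := Real.mul_rpow hB0.le hx0.le

/-- **(I4T) of stub S11 from the named fact `SmirnovWerner2001_fourArm_scalingLimit`**: the two-radius cluster-form
four-arm bound with exponent `> 1` for critical site percolation on `𝕋`, at every centre. -/
theorem fourArmTwoClustersBoundT_of_scalingLimit : SmirnovWerner2001_fourArm_scalingLimit → FourArmTwoClustersBoundT :=
  fun h ↦ fourArmTwoClustersBoundT_of_critFourArmProb_le (critFourArmProb_twoRadius_of_scalingLimit h)

end Summit.CriticalPhenomena.CardyFormulaZ2.Cruxes.NestingRigidity.PinchResampling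

end
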